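import Summits.QuantumAdvantage.QuantumAdvantage.Theorems.CharDialStrataDialC
import Summits.QuantumAdvantage.QuantumAdvantage.Theorems.CharDialIslandDialC
import HarnessLib

/-!
# CharDialGammaDialA — TREE PART A of the decomp-qadv lens-5 g32 node «GammaDial» on `CharDial.FrobStructureLawOdd`
# (stmt-QuantumAdvantage-27205): PIECE E SUFFICES — `lawAt_of_exchCoreAt : IslandDial.ExchCoreAt p → (law 2½ at p)`,
# hence `target_iff_exchCoreOdd : FrobStructureLawOdd ↔ ExchCoreOdd`, `target_iff_tabOdd : FrobStructureLawOdd ↔ TableDial.TabOdd`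
# and `closes : TabOdd → FrobStructureLawOdd` BY NAME; piece I (`IslandDial.IslandOdd`) of the g28 split is a CONSEQUENCE of piece E.

The argument (lonely coordinates): Ramsey with colours `𝔽_p` (tree `SubChar.ramsey_finite_colours`) on the set `W` of relevant coordinates
with fewer than `p − 1` exchange partners; colour `0` is excluded by `SubChar.topZero_bounded`, a colour `γ ≠ 0` by `ExchCoreAt` itself (an
exchangeable `Y ⊆ W`, `|Y| ≥ p − 1`, would make a lonely coordinate sociable); so `|W| < N(p)`, swap classes are closed under conjugation
(`SubChar.swapInv_conj`), and the tree's L2G end `SubChar.law_of_exchange_partners` with junta `W` is the normal form.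
Verbatim `section Lonely` of the node file (namespace `Theorems.GammaDial`); no definitions, no `sorry`, no instances, no notation.
-/

set_option autoImplicit false
set_option linter.dupNamespace false

namespace Summit.QuantumAdvantage.QuantumAdvantage.Theorems.GammaDial

open Finset
open Summit.QuantumAdvantage.AdviceFreeQNC0
open Literature.Computability.MetaComplexity Literature.Computability.MetaComplexity.Smolensky
open Summit.QuantumAdvantage.QuantumAdvantage.Theorems.IslandDial (Relevant Exch TopConst NormalForm ExchCoreAt ExchCoreOdd IslandAt
  IslandOdd exchCoreOdd_of_target islandOdd_of_target)
open Summit.QuantumAdvantage.QuantumAdvantage.Theorems.TableDial (TabLaw TabAt TabOdd tabLaw_all_of_core tabAt_iff_all tabOdd_of_target)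
open Summit.QuantumAdvantage.QuantumAdvantage.Theorems.StrataDial (SwapInv exchCoreAt_iff_tabAt)

/-! ### §1 LONELY COORDINATES — piece E suffices (piece I of g28 is a consequence of piece E) -/

section Lonely

/-- ★ **PIECE E SUFFICES.**  `ExchCoreAt p` alone gives law 2½ at `p`: Ramsey (colours `𝔽_p`, tree `SubChar.ramsey_finite_colours`) on the
set `W` of LONELY relevant coordinates (fewer than `p − 1` exchange partners) — colour `0` is excluded by `SubChar.topZero_bounded`, a colour
`γ ≠ 0` by `ExchCoreAt` (an exchangeable `Y ⊆ W` with `|Y| ≥ p − 1` makes a lonely coordinate sociable); so `|W| < N`, every relevant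
coordinate off `W` has `≥ p − 1` partners off `W` (swap classes are closed under conjugation, tree `SubChar.swapInv_conj`), and the tree's
L2G end `SubChar.law_of_exchange_partners` with junta `W` is the normal form. -/
theorem lawAt_of_exchCoreAt (p : ℕ) [hp : Fact p.Prime] (hE : ExchCoreAt p) :
    ∃ J₀ : ℕ, ∀ (n : ℕ) (f : (Fin n → Bool) → Bool), HasDegF p f (p - 1) → NormalForm p f J₀ := by
  classical
  obtain ⟨M₀, hM₀⟩ := SubChar.topZero_bounded p
  obtain ⟨E, hE⟩ := hE
  obtain ⟨N, hN⟩ := SubChar.ramsey_finite_colours (ZMod p) (p - 1) (max (M₀ + 1) (E + (p - 1)))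
  refine ⟨N, fun n f hf => ?_⟩
  -- swap classes and the LONELY set `W`
  let C : Fin n → Finset (Fin n) := fun i => Finset.univ.filter fun j => ∀ u : Fin n → Bool, f (u ∘ Equiv.swap i j) = f u
  have hCmem : ∀ i j, j ∈ C i ↔ ∀ u : Fin n → Bool, f (u ∘ Equiv.swap i j) = f u := by
    intro i j; simp [C]
  let W : Finset (Fin n) := Finset.univ.filter fun i => Relevant f i ∧ (C i).card < p - 1
  have hWmem : ∀ i, i ∈ W ↔ Relevant f i ∧ (C i).card < p - 1 := by
    intro i; simp [W]
  -- ASYMPTOTIC REGIME: the lonely set is small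
  have hW : W.card < N := by
    by_contra hWN
    obtain ⟨X, hXW, hMX, γ, hγ⟩ := hN (Fin n) W (not_lt.1 hWN) (fun T => SubLog.moeb (SubLog.indR (ZMod p) f) T)
    have hXrel : ∀ i ∈ X, Relevant f i := fun i hi => ((hWmem i).1 (hXW hi)).1
    by_cases hγ0 : γ = 0
    · have hle := hM₀ n f X hf hXrel (fun T hT hc => by rw [hγ T hT hc, hγ0])
      have h1 : M₀ + 1 ≤ X.card := le_trans (le_max_left _ _) hMX
      omega
    · obtain ⟨Y, hYX, hcard, hex⟩ := hE n f X hf ⟨γ, hγ0, hγ⟩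
      have h2 : E + (p - 1) ≤ X.card := le_trans (le_max_right _ _) hMX
      have hp1 : 1 ≤ p - 1 := by have := hp.out.two_le; omega
      obtain ⟨i, hi⟩ : Y.Nonempty := Finset.card_pos.1 (by omega)
      have hsub : Y ⊆ C i := fun j hj => (hCmem i j).2 (hex i hi j hj)
      have hlt : (C i).card < p - 1 := ((hWmem i).1 (hXW (hYX hi))).2
      have := Finset.card_le_card hsub
      omega
  -- BRIDGE: every relevant coordinate off `W` has `≥ p − 1` exchange partners off `W`
  have hbig : ∀ i, i ∉ W → (∃ (u : Fin n → Bool) (b : Bool), f (Function.update u i b) ≠ f u) →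
      p - 1 ≤ (Finset.univ.filter fun j => j ∉ W ∧ ∀ u : Fin n → Bool, f (u ∘ Equiv.swap i j) = f u).card := by
    intro i hiW hrel
    have hCi : p - 1 ≤ (C i).card := by
      by_contra h
      exact hiW ((hWmem i).2 ⟨hrel, not_le.1 h⟩)
    refine le_trans hCi (Finset.card_le_card fun j hj => ?_)
    have hij : ∀ u : Fin n → Bool, f (u ∘ Equiv.swap i j) = f u := (hCmem i j).1 hj
    refine Finset.mem_filter.2 ⟨Finset.mem_univ _, fun hjW => ?_, hij⟩
    have hsub : C i ⊆ C j := fun k hk => (hCmem j k).2 (SubChar.swapInv_conj f hij ((hCmem i k).1 hk))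
    have hlt : (C j).card < p - 1 := ((hWmem j).1 hjW).2
    have := Finset.card_le_card hsub
    omega
  -- FINITE RANGE: the junta is the lonely set
  obtain ⟨c, h, hh⟩ := SubChar.law_of_exchange_partners p W f hbig hf
  refine ⟨W, le_of_lt hW, c, fun u s => h (JLin.proj W u) s, ?_, fun u => hh u⟩
  intro u v huv s
  show h (JLin.proj W u) s = h (JLin.proj W v) s
  congr 1
  funext i
  unfold JLin.proj
  by_cases hi : i ∈ W
  · rw [if_pos hi, if_pos hi, huv i hi]
  · rw [if_neg hi, if_neg hi]

/-- Piece I at `p` is a CONSEQUENCE of piece E at `p` (g28's AND had a redundant conjunct). -/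
theorem islandAt_of_exchCoreAt (p : ℕ) [Fact p.Prime] (hE : ExchCoreAt p) : IslandAt p := by
  obtain ⟨J₀, hJ₀⟩ := lawAt_of_exchCoreAt p hE
  exact ⟨J₀, fun n f _ hf _ _ _ => hJ₀ n f hf⟩

/-- Law 2½ at `p` from the finite, level-free TABLE CORE at `p` alone (g31 `exchCoreAt_iff_tabAt` + `lawAt_of_exchCoreAt`). -/
theorem lawAt_of_tabAt (p : ℕ) [Fact p.Prime] (hT : TabAt p) :
    ∃ J₀ : ℕ, ∀ (n : ℕ) (f : (Fin n → Bool) → Bool), HasDegF p f (p - 1) → NormalForm p f J₀ :=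
  lawAt_of_exchCoreAt p ((exchCoreAt_iff_tabAt p).2 hT)

/-- … explicitly from one table core `TabLaw p K (2K+1)`. -/
theorem lawAt_of_core (p : ℕ) [Fact p.Prime] {K : ℕ} (hcore : TabLaw p K (2 * K + 1)) :
    ∃ J₀ : ℕ, ∀ (n : ℕ) (f : (Fin n → Bool) → Bool), HasDegF p f (p - 1) → NormalForm p f J₀ :=
  lawAt_of_tabAt p ⟨K, hcore⟩

/-- Piece I at `p` from the table core at `p`. -/
theorem islandAt_of_tabAt (p : ℕ) [Fact p.Prime] (hT : TabAt p) : IslandAt p :=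
  islandAt_of_exchCoreAt p ((exchCoreAt_iff_tabAt p).2 hT)

/-- `IslandOdd` STRUCK OFF the residual: it follows from `ExchCoreOdd`. -/
theorem islandOdd_of_exchCoreOdd (hE : ExchCoreOdd) : IslandOdd := fun p _ hp5 => islandAt_of_exchCoreAt p (hE p hp5)

/-- `IslandOdd` from «Tab». -/
theorem islandOdd_of_tabOdd (hT : TabOdd) : IslandOdd := fun p _ hp5 => islandAt_of_tabAt p (hT p hp5)

/-- **`closes`** — the node's junction onto the live item BY NAME: `TableDial.TabOdd → CharDial.FrobStructureLawOdd`
(stmt-QuantumAdvantage-27205); ONE hypothesis (g31's `closes` needed `IslandOdd` too). -/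
theorem closes (hT : TabOdd) : Summit.QuantumAdvantage.QuantumAdvantage.Theses.CharDial.FrobStructureLawOdd := by
  intro p _ hp5
  obtain ⟨J₀, hJ₀⟩ := lawAt_of_tabAt p (hT p hp5)
  exact ⟨J₀, fun n f hf => hJ₀ n f hf⟩

/-- ★★★ **T IS EXACTLY PIECE E**: `FrobStructureLawOdd ↔ ExchCoreOdd`. -/
theorem target_iff_exchCoreOdd : Summit.QuantumAdvantage.QuantumAdvantage.Theses.CharDial.FrobStructureLawOdd ↔ ExchCoreOdd :=
  ⟨exchCoreOdd_of_target, fun hE => Summit.QuantumAdvantage.QuantumAdvantage.Theorems.IslandDial.closes hE (islandOdd_of_exchCoreOdd hE)⟩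

/-- ★★★ **T IS EXACTLY THE TABLE CORES**: `FrobStructureLawOdd ↔ TabOdd` — law 2½ over the odd primes `≥ 5` is EQUIVALENT to the
finite, level-free table core `∃ K, TabLaw p K (2K+1)` at each prime. -/
theorem target_iff_tabOdd : Summit.QuantumAdvantage.QuantumAdvantage.Theses.CharDial.FrobStructureLawOdd ↔ TabOdd :=
  ⟨tabOdd_of_target, closes⟩

end Lonely

end Summit.QuantumAdvantage.QuantumAdvantage.Theorems.GammaDial
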